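import Literature.Combinatorics.StablePolynomials.StableDiagonalPolynomials
import HarnessLib

/-!
# Stable polynomials in the products `z_i w_i` factor (Borcea–Brändén II, Lemma 4.3)

J. Borcea, P. Brändén, *The Lee–Yang and Pólya–Schur programs. II. Theory of stable polynomials and
applications*, Comm. Pure Appl. Math. 62 (2009) 1595–1631 (arXiv:0809.3087), §4:

> **Lemma 4.3.** Let `f(z,w) = Σ_{α ∈ ℕⁿ} a(α) z^α w^α ∈ ℂ[z_1,…,z_n,w_1,…,w_n]`. Then `f` is stable if and only if
> it can be written as `f(z,w) = C f_1(z_1w_1)⋯f_n(z_nw_n)`, where `C ∈ ℂ` and `f_1(t),…,f_n(t)` are univariate real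
> polynomials with real and non-negative zeros only.
>
> *Proof.* The sufficiency part follows simply by noticing that if `μ ≤ 0` then `μ + zw` is a stable polynomial in
> two variables. […] We want to show that
> `λ(α) = λ(ξ)^{-n+1} λ(ξ+(α_1-ξ_1)e_1)⋯λ(ξ+(α_n-ξ_n)e_n)`, `ξ ≤ α ≤ κ`. (split)
> This will then prove the necessity part since `f` will split into a product as in the statement of the lemma and
> the polynomials `f_j(t)`, `1 ≤ j ≤ n`, will have the desired properties since `f_j(z_jw_j)` is necessarily stable.
> […] Now, it is easy to check that `a + bz + cw + dzw ∈ ℝ[z,w]` is stable `⟺ bc ≥ ad` (peacy) […]. Let `γ ∈ ℕⁿ`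
> and `1 ≤ i,j ≤ n` be such that `γ + e_i + e_j ≤ κ`. Applying `T` to the polynomials `z^γ(1+z_i)(1+z_j)` and
> `z^γ(1-z_i)(1+z_j)` and keeping (peacy) and (easypeacy) in mind we see that […]
> `λ(γ)λ(γ+e_i+e_j) = λ(γ+e_i)λ(γ+e_j)` whenever `γ ∈ ℕⁿ` and `γ + e_i + e_j ≤ κ`. (lambdas)
> From (lambdas) and [Br1] we deduce that `λ(γ) > 0` for all `ξ ≤ γ ≤ κ`. The proposed formula (split) now follows by
> induction over `k := |α| - |ξ|`.

This file completes the proof begun in `StableDiagonalPolynomials.lean` (support `= [ξ,κ]`, the stability preserver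
`T = diagOp g` with multipliers `λ = diagMultiplier g`, the phase `u` and the real multipliers `μ = uλ =
realMultiplier g u`, positive exactly on the box):

* §1 **(peacy)**, necessity half, `mul_le_mul_of_isUpperHalfPlaneStable_affine` (an explicit zero
  `(i, -(a+bi)/(c+di)) ∈ H²` when `ad > bc`); `coeffs_eq_zero_of_affine_eq_zero`.
* §2 The test polynomials `z^γ(1 + s z_i)(1 + z_j)` (`probePoly`, `s = ±1`), `diagOp_probePoly`, and **(lambdas)**
  `realMultiplier_mul_eq` (`i ≠ j`; (easypeacy), the case `i = j`, is not needed for (split)).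
* §3 **(split)** `realMultiplier_split`: `μ(α) = μ(ξ) Π_l ν_l(α_l - ξ_l)` with `ν_l(k) = μ(ξ + k e_l)/μ(ξ)`
  (`lineMultiplier`), by strong induction on `|α - ξ|`.
* §4 **Lemma 4.3** `isUpperHalfPlaneStable_diagSubst_iff` (both directions; the factors `factorPoly g u l ∈ ℝ[t]`,
  the factorisation `eq_C_mul_prod_factorPoly`, the zeros of the factors `roots_of_isUpperHalfPlaneStable_diagSubst`,
  sufficiency `isUpperHalfPlaneStable_diagSubst_of_eq`), and the form on `f(z,w)` itself,
  `IsUpperHalfPlaneStable.exists_diagSubst_eq_prod`. The constant `C ≠ 0` is made explicit (the zero polynomial is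
  not stable in the tree's convention, as in [BorceaBranden2009II]).

## References

* [BorceaBranden2009II] J. Borcea, P. Brändén, Comm. Pure Appl. Math. 62 (2009) 1595–1631, §4 Lemma 4.3 and its
  proof (eqs. (split), (peacy), (lambdas)).
* [Branden2007] P. Brändén, Adv. Math. 216 (2007), §3 Thm. 3.2, Cor. 3.7 ("[Br1]").
-/

noncomputable section

open MvPolynomial Finset

namespace Literature.Combinatorics.StablePolynomials

variable {τ : Type*}

/-! ## §1 The affine criterion `a + bz + cw + dzw` stable `⇒ bc ≥ ad` (peacy) -/

section Peacy

variable [DecidableEq τ]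

/-- **(peacy), necessity half: "`a + bz + cw + dzw ∈ ℝ[z,w]` is stable `⟺ bc ≥ ad`"** — if `ad > bc` then
`(z,w) = (i, -(a+bi)/(c+di))` is a zero in `H²` (`Im w = (ad-bc)/(c²+d²) > 0`). Here `z = z_i`, `w = z_j`, `i ≠ j`.
[cite: BorceaBranden2009II, §4 proof of Lemma 4.3, eq. (peacy) ("see, e.g., [Br1] or just adapt the arguments in the
proof of Lemma 5.4")] -/
theorem mul_le_mul_of_isUpperHalfPlaneStable_affine {i j : τ} (hij : i ≠ j) {a b c d : ℝ}
    (h : IsUpperHalfPlaneStable (C (a : ℂ) + C (b : ℂ) * X i + C (c : ℂ) * X j + C (d : ℂ) * (X i * X j) :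
      MvPolynomial τ ℂ)) : a * d ≤ b * c := by
  by_contra hlt
  push Not at hlt
  have hcd : 0 < c ^ 2 + d ^ 2 := by
    by_contra h0
    push Not at h0
    have hc : c = 0 := by nlinarith [sq_nonneg c, sq_nonneg d]
    have hd : d = 0 := by nlinarith [sq_nonneg c, sq_nonneg d]
    rw [hc, hd, mul_zero, mul_zero] at hlt
    exact lt_irrefl _ hlt
  have hden : (c : ℂ) + d * Complex.I ≠ 0 := by
    intro h0
    have h1 := congrArg Complex.re h0
    have h2 := congrArg Complex.im h0
    simp at h1 h2
    rw [h1, h2] at hcd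
    simp at hcd
  set w0 : ℂ := -((a : ℂ) + b * Complex.I) / (c + d * Complex.I) with hw0
  have hns : Complex.normSq ((c : ℂ) + d * Complex.I) = c ^ 2 + d ^ 2 := by
    rw [Complex.normSq_apply]; simp; ring
  have hw0im : 0 < w0.im := by
    rw [hw0, Complex.div_im, hns]
    have hre : (-((a : ℂ) + b * Complex.I)).re = -a := by simp
    have him : (-((a : ℂ) + b * Complex.I)).im = -b := by simp
    have hre' : ((c : ℂ) + d * Complex.I).re = c := by simp
    have him' : ((c : ℂ) + d * Complex.I).im = d := by simp
    rw [hre, him, hre', him']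
    have : -b * c / (c ^ 2 + d ^ 2) - -a * d / (c ^ 2 + d ^ 2) = (a * d - b * c) / (c ^ 2 + d ^ 2) := by ring
    rw [this]
    exact div_pos (by linarith) hcd
  set Z : τ → ℂ := Function.update (fun _ => Complex.I) j w0 with hZ
  have hZi : Z i = Complex.I := by rw [hZ, Function.update_of_ne hij]
  have hZj : Z j = w0 := by rw [hZ, Function.update_self]
  have hZim : ∀ l, 0 < (Z l).im := fun l => by
    by_cases hl : l = j
    · subst hl; rw [hZj]; exact hw0im
    · rw [hZ, Function.update_of_ne hl]; simp
  have hmul : w0 * ((c : ℂ) + d * Complex.I) = -((a : ℂ) + b * Complex.I) := by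
    rw [hw0]; exact div_mul_cancel₀ _ hden
  apply h Z hZim
  simp only [map_add, _root_.map_mul, eval_C, eval_X, hZi, hZj]
  linear_combination hmul

/-- The coefficients of `a + bz_i + cz_j + dz_iz_j = 0` vanish (evaluate at `0`, `e_i`, `e_j`, `e_i + e_j`).
[cite: BorceaBranden2009II, §4 proof of Lemma 4.3, eq. (peacy)] -/
theorem coeffs_eq_zero_of_affine_eq_zero {i j : τ} (hij : i ≠ j) {a b c d : ℂ}
    (h : (C a + C b * X i + C c * X j + C d * (X i * X j) : MvPolynomial τ ℂ) = 0) :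
    a = 0 ∧ b = 0 ∧ c = 0 ∧ d = 0 := by
  have hev : ∀ x : τ → ℂ, a + b * x i + c * x j + d * (x i * x j) = 0 := fun x => by
    have := congrArg (eval x) h
    simpa only [map_add, _root_.map_mul, eval_C, eval_X, map_zero] using this
  have h0 := hev (fun _ => 0)
  have h1 := hev (Function.update (fun _ => 0) i 1)
  have h2 := hev (Function.update (fun _ => 0) j 1)
  have h3 := hev (fun _ => 1)
  simp only [Function.update_self, Function.update_of_ne hij, Function.update_of_ne (Ne.symm hij)] at h1 h2
  simp only [mul_zero, add_zero, mul_one] at h0 h1 h2 h3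
  refine ⟨h0, ?_, ?_, ?_⟩
  · rw [h0, zero_add] at h1; exact h1
  · rw [h0, zero_add] at h2; exact h2
  · rw [h0] at h1 h2 h3
    simp only [zero_add] at h1 h2 h3
    rw [h1, h2, zero_add, zero_add] at h3
    exact h3

end Peacy

/-! ## §2 The relations `λ(γ)λ(γ+e_i+e_j) = λ(γ+e_i)λ(γ+e_j)` -/

section Lambdas

variable [Fintype τ] [DecidableEq τ]

omit [Fintype τ] [DecidableEq τ] in
/-- `c z^{m + e_i} = (c z^m) · z_i`. [cite: BorceaBranden2009II, §4 proof of Lemma 4.3 (the polynomials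
`z^γ(1 ± z_i)(1 + z_j)`)] -/
theorem monomial_add_single_eq_mul_X (m : τ →₀ ℕ) (i : τ) (c : ℂ) :
    (monomial (m + Finsupp.single i 1) c : MvPolynomial τ ℂ) = monomial m c * X i := by
  rw [show (X i : MvPolynomial τ ℂ) = monomial (Finsupp.single i 1) 1 from rfl, monomial_mul, mul_one]

/-- **The test polynomials `z^γ (1 + s z_i)(1 + z_j)`** (`s = ±1` in the printed proof).
[cite: BorceaBranden2009II, §4 proof of Lemma 4.3 ("Applying `T` to the polynomials `z^γ(1+z_i)(1+z_j)` and
`z^γ(1-z_i)(1+z_j)`")] -/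
def probePoly (γ : τ →₀ ℕ) (i j : τ) (s : ℂ) : MvPolynomial τ ℂ :=
  monomial γ 1 * ((1 + C s * X i) * (1 + X j))

omit [Fintype τ] [DecidableEq τ] in
/-- `z^γ (1 + s z_i)(1 + z_j)` is stable for real `s`. [cite: BorceaBranden2009II, §4 proof of Lemma 4.3] -/
theorem isUpperHalfPlaneStable_probePoly (γ : τ →₀ ℕ) (i j : τ) (s : ℝ) :
    IsUpperHalfPlaneStable (probePoly γ i j (s : ℂ)) := by
  intro z hz
  have hz0 : ∀ l, z l ≠ 0 := fun l h0 => by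
    have := hz l
    rw [h0, Complex.zero_im] at this
    exact lt_irrefl _ this
  rw [probePoly, _root_.map_mul, _root_.map_mul, eval_monomial, one_mul]
  simp only [map_add, map_one, _root_.map_mul, eval_C, eval_X]
  refine mul_ne_zero (Finsupp.prod_ne_zero_iff.2 fun l _ => pow_ne_zero _ (hz0 l)) (mul_ne_zero ?_ ?_)
  · intro h0
    have := congrArg Complex.im h0
    simp only [Complex.add_im, Complex.one_im, Complex.mul_im, Complex.ofReal_re, Complex.ofReal_im, zero_mul,
      add_zero, zero_add, Complex.zero_im] at this
    rcases eq_or_ne s 0 with hs | hs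
    · rw [hs] at h0
      simp at h0
    · exact (mul_ne_zero hs (hz i).ne') this
  · intro h0
    have := congrArg Complex.im h0
    simp only [Complex.add_im, Complex.one_im, zero_add, Complex.zero_im] at this
    exact (hz j).ne' this

omit [Fintype τ] in
/-- `deg_{z_l} [z^γ(1 + s z_i)(1 + z_j)] ≤ (γ + e_i + e_j)_l`. [cite: BorceaBranden2009II, §4 proof of Lemma 4.3
("`γ + e_i + e_j ≤ κ`")] -/
theorem degreeOf_probePoly_le (γ : τ →₀ ℕ) (i j : τ) (s : ℂ) (l : τ) :
    degreeOf l (probePoly γ i j s) ≤ (γ + Finsupp.single i 1 + Finsupp.single j 1 : τ →₀ ℕ) l := by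
  rw [probePoly, Finsupp.add_apply, Finsupp.add_apply, add_assoc]
  refine (degreeOf_mul_le _ _ _).trans (add_le_add ?_ ((degreeOf_mul_le _ _ _).trans (add_le_add ?_ ?_)))
  · rw [degreeOf_monomial_eq _ _ one_ne_zero]
  · refine (degreeOf_add_le _ _ _).trans (max_le ?_ ?_)
    · rw [← C_1, degreeOf_C]; exact Nat.zero_le _
    · refine (degreeOf_C_mul_le _ _ _).trans ?_
      rw [degreeOf_X, Finsupp.single_apply]
      split_ifs with h1 h2 h2
      · exact le_rfl
      · exact absurd h1.symm h2
      · exact absurd h2.symm h1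
      · exact le_rfl
  · refine (degreeOf_add_le _ _ _).trans (max_le ?_ ?_)
    · rw [← C_1, degreeOf_C]; exact Nat.zero_le _
    · rw [degreeOf_X, Finsupp.single_apply]
      split_ifs with h1 h2 h2
      · exact le_rfl
      · exact absurd h1.symm h2
      · exact absurd h2.symm h1
      · exact le_rfl

omit [DecidableEq τ] in
/-- **`T[z^γ(1 + s z_i)(1 + z_j)] = z^γ (λ(γ) + sλ(γ+e_i) z_i + λ(γ+e_j) z_j + sλ(γ+e_i+e_j) z_iz_j)`.**
[cite: BorceaBranden2009II, §4 proof of Lemma 4.3 ("Applying `T` to the polynomials `z^γ(1+z_i)(1+z_j)` and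
`z^γ(1-z_i)(1+z_j)`")] -/
theorem diagOp_probePoly (g : MvPolynomial τ ℂ) (γ : τ →₀ ℕ) (i j : τ) (s : ℂ) :
    diagOp g (probePoly γ i j s) = monomial γ 1 *
      (C (diagMultiplier g γ) + C (s * diagMultiplier g (γ + Finsupp.single i 1)) * X i +
        C (diagMultiplier g (γ + Finsupp.single j 1)) * X j +
        C (s * diagMultiplier g (γ + Finsupp.single i 1 + Finsupp.single j 1)) * (X i * X j)) := by
  have hexp : probePoly γ i j s = monomial γ 1 + C s * monomial (γ + Finsupp.single i 1) 1 +
      monomial (γ + Finsupp.single j 1) 1 + C s * monomial (γ + Finsupp.single i 1 + Finsupp.single j 1) 1 := by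
    simp only [probePoly, monomial_add_single_eq_mul_X]
    ring
  rw [hexp, map_add, map_add, map_add, C_mul_monomial, C_mul_monomial, diagOp_monomial, diagOp_monomial,
    diagOp_monomial, diagOp_monomial]
  simp only [mul_one, monomial_add_single_eq_mul_X]
  set M : MvPolynomial τ ℂ := monomial γ 1 with hM
  have hMc : ∀ c : ℂ, (monomial γ c : MvPolynomial τ ℂ) = C c * M := fun c => by rw [hM, C_mul_monomial, mul_one]
  rw [hMc (diagMultiplier g γ), hMc (diagMultiplier g _ * s), hMc (diagMultiplier g (γ + Finsupp.single j 1)),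
    hMc (diagMultiplier g _ * s)]
  simp only [_root_.map_mul]
  ring

/-- **One probe.** For real `s` and `γ + e_i + e_j ≤ κ` (`i ≠ j`):
`μ(γ)·(s μ(γ+e_i+e_j)) ≤ (s μ(γ+e_i))·μ(γ+e_j)` — (peacy) applied to `u·T[z^γ(1 + s z_i)(1 + z_j)]`, which is
stable with real coefficients (or zero). [cite: BorceaBranden2009II, §4 proof of Lemma 4.3 ("keeping (peacy) and
(easypeacy) in mind we see that `λ(γ)λ(γ+e_i+e_j) ≥ λ(γ+e_i)λ(γ+e_j)` and `λ(γ)λ(γ+e_i+e_j) ≤ λ(γ+e_i)λ(γ+e_j)`")] -/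
theorem realMultiplier_probe {g : MvPolynomial τ ℂ} (hst : IsUpperHalfPlaneStable (diagSubst g)) {u : ℂ}
    (hu1 : ‖u‖ = 1)
    (hu : ∀ α : τ →₀ ℕ, (u * ((-1) ^ α.degree * coeff α g)).im = 0 ∧ 0 ≤ (u * ((-1) ^ α.degree * coeff α g)).re)
    {γ : τ →₀ ℕ} {i j : τ} (hij : i ≠ j) (hγ : γ + Finsupp.single i 1 + Finsupp.single j 1 ≤ degVec g) (s : ℝ) :
    realMultiplier g u γ * (s * realMultiplier g u (γ + Finsupp.single i 1 + Finsupp.single j 1)) ≤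
      (s * realMultiplier g u (γ + Finsupp.single i 1)) * realMultiplier g u (γ + Finsupp.single j 1) := by
  have hu0 : u ≠ 0 := fun h => by rw [h, norm_zero] at hu1; exact zero_ne_one hu1
  set Q : MvPolynomial τ ℂ := C (diagMultiplier g γ) + C ((s : ℂ) * diagMultiplier g (γ + Finsupp.single i 1)) * X i +
      C (diagMultiplier g (γ + Finsupp.single j 1)) * X j +
      C ((s : ℂ) * diagMultiplier g (γ + Finsupp.single i 1 + Finsupp.single j 1)) * (X i * X j) with hQ
  have hT : diagOp g (probePoly γ i j (s : ℂ)) = monomial γ 1 * Q := diagOp_probePoly g γ i j s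
  -- `u · Q` has the real coefficients `μ`
  have huQ : C u * Q = C ((realMultiplier g u γ : ℝ) : ℂ) +
      C ((s * realMultiplier g u (γ + Finsupp.single i 1) : ℝ) : ℂ) * X i +
      C ((realMultiplier g u (γ + Finsupp.single j 1) : ℝ) : ℂ) * X j +
      C ((s * realMultiplier g u (γ + Finsupp.single i 1 + Finsupp.single j 1) : ℝ) : ℂ) * (X i * X j) := by
    rw [hQ]
    simp only [Complex.ofReal_mul, realMultiplier_eq hu, mul_add, ← mul_assoc, ← _root_.map_mul]
    congr 3 <;> ring_nf
  rcases diagOp_stable_or_zero hst (fun l => (degreeOf_probePoly_le γ i j (s : ℂ) l).trans (Finsupp.le_def.1 hγ l))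
      (isUpperHalfPlaneStable_probePoly γ i j s) with hstab | hzero
  · -- stable: (peacy) for `u Q`
    rw [hT] at hstab
    have hQst : IsUpperHalfPlaneStable (C u * Q) :=
      (isUpperHalfPlaneStable_C hu0).mul (isUpperHalfPlaneStable_mul_iff.1 hstab).2
    rw [huQ] at hQst
    have := mul_le_mul_of_isUpperHalfPlaneStable_affine hij hQst
    linarith
  · -- zero: all four `μ` vanish
    rw [hT] at hzero
    have hQ0 : Q = 0 := by
      rcases mul_eq_zero.1 hzero with h | h
      · exact absurd (monomial_eq_zero.1 h) one_ne_zero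
      · exact h
    have huQ0 : C u * Q = 0 := by rw [hQ0, mul_zero]
    rw [huQ] at huQ0
    obtain ⟨h0, h1, h2, h3⟩ := coeffs_eq_zero_of_affine_eq_zero hij huQ0
    have e0 : realMultiplier g u γ = 0 := by exact_mod_cast h0
    have e3 : s * realMultiplier g u (γ + Finsupp.single i 1 + Finsupp.single j 1) = 0 := by exact_mod_cast h3
    rw [e0, e3, zero_mul]
    have e1 : s * realMultiplier g u (γ + Finsupp.single i 1) = 0 := by exact_mod_cast h1
    rw [e1, zero_mul]

/-- **(lambdas): `λ(γ)λ(γ+e_i+e_j) = λ(γ+e_i)λ(γ+e_j)` whenever `γ + e_i + e_j ≤ κ`, `i ≠ j`** (for the normalised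
real multipliers `μ = uλ`), from the two probes `s = 1` and `s = -1`. [cite: BorceaBranden2009II, §4 proof of
Lemma 4.3, eq. (lambdas)] -/
theorem realMultiplier_mul_eq {g : MvPolynomial τ ℂ} (hst : IsUpperHalfPlaneStable (diagSubst g)) {u : ℂ}
    (hu1 : ‖u‖ = 1)
    (hu : ∀ α : τ →₀ ℕ, (u * ((-1) ^ α.degree * coeff α g)).im = 0 ∧ 0 ≤ (u * ((-1) ^ α.degree * coeff α g)).re)
    {γ : τ →₀ ℕ} {i j : τ} (hij : i ≠ j) (hγ : γ + Finsupp.single i 1 + Finsupp.single j 1 ≤ degVec g) :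
    realMultiplier g u γ * realMultiplier g u (γ + Finsupp.single i 1 + Finsupp.single j 1) =
      realMultiplier g u (γ + Finsupp.single i 1) * realMultiplier g u (γ + Finsupp.single j 1) := by
  have h1 := realMultiplier_probe hst hu1 hu hij hγ 1
  have h2 := realMultiplier_probe hst hu1 hu hij hγ (-1)
  simp only [one_mul] at h1
  refine le_antisymm h1 ?_
  linarith

end Lambdas

/-! ## §3 The splitting `λ(α) = λ(ξ)^{1-n} Π_i λ(ξ + (α_i - ξ_i)e_i)` -/

section Split

variable [Fintype τ] [DecidableEq τ]

/-- **The one-dimensional sequences `ν_l(k) = μ(ξ + k e_l)/μ(ξ)`.** [cite: BorceaBranden2009II, §4 proof of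
Lemma 4.3, eq. (split) (the factors `λ(ξ + (α_i - ξ_i)e_i)`, normalised by `λ(ξ)`)] -/
def lineMultiplier (g : MvPolynomial τ ℂ) (u : ℂ) (l : τ) (k : ℕ) : ℝ :=
  realMultiplier g u (infVec g + Finsupp.single l k) / realMultiplier g u (infVec g)

/-- **(split): `μ(α) = μ(ξ) Π_l ν_l(α_l - ξ_l)` for `ξ ≤ α ≤ κ`**, i.e.
`λ(α) = λ(ξ)^{-n+1} λ(ξ+(α_1-ξ_1)e_1)⋯λ(ξ+(α_n-ξ_n)e_n)`, "by induction over `k := |α| - |ξ|`" from (lambdas) and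
the positivity `λ(γ) > 0` on the box. [cite: BorceaBranden2009II, §4 proof of Lemma 4.3, eq. (split)] -/
theorem realMultiplier_split {g : MvPolynomial τ ℂ} (hst : IsUpperHalfPlaneStable (diagSubst g)) {u : ℂ}
    (hu1 : ‖u‖ = 1)
    (hu : ∀ α : τ →₀ ℕ, (u * ((-1) ^ α.degree * coeff α g)).im = 0 ∧ 0 ≤ (u * ((-1) ^ α.degree * coeff α g)).re)
    {α : τ →₀ ℕ} (h1 : infVec g ≤ α) (h2 : α ≤ degVec g) :
    realMultiplier g u α =
      realMultiplier g u (infVec g) * ∏ l, lineMultiplier g u l (α l - infVec g l) := by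
  set ξ := infVec g with hξ
  set κ := degVec g with hκ
  set μ := realMultiplier g u with hμ
  set ν := lineMultiplier g u with hν
  have hμpos : ∀ γ, ξ ≤ γ → γ ≤ κ → 0 < μ γ := fun γ hγ1 hγ2 =>
    (realMultiplier_pos_iff hst hu1 hu γ).2 ⟨hγ1, hγ2⟩
  have hμξ : 0 < μ ξ := hμpos ξ le_rfl (infVec_le_degVec hst)
  have hν0 : ∀ l, ν l 0 = 1 := fun l => by
    rw [hν, lineMultiplier, Finsupp.single_zero, add_zero]
    exact div_self hμξ.ne'
  -- strong induction on `|α - ξ|`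
  suffices H : ∀ (N : ℕ) (α : τ →₀ ℕ), (α - ξ).degree ≤ N → ξ ≤ α → α ≤ κ →
      μ α = μ ξ * ∏ l, ν l (α l - ξ l) from H _ α le_rfl h1 h2
  intro N
  induction N with
  | zero =>
    intro α hN h1 _
    have h0 : α - ξ = 0 := (Finsupp.degree_eq_zero_iff _).1 (Nat.le_zero.1 hN)
    have hαξ : α = ξ := le_antisymm (Finsupp.le_def.2 fun l => by
      have := DFunLike.congr_fun h0 l
      rw [Finsupp.tsub_apply, Finsupp.coe_zero, Pi.zero_apply] at this
      omega) h1
    rw [hαξ, prod_eq_one (fun l _ => by rw [Nat.sub_self]; exact hν0 l), mul_one]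
  | succ N ih =>
    intro α hN h1 h2
    by_cases hαξ : α = ξ
    · rw [hαξ, prod_eq_one (fun l _ => by rw [Nat.sub_self]; exact hν0 l), mul_one]
    obtain ⟨i, hi⟩ : ∃ i, ξ i < α i := by
      by_contra h
      push Not at h
      exact hαξ (le_antisymm (Finsupp.le_def.2 h) h1)
    by_cases hone : ∀ l, l ≠ i → α l = ξ l
    · -- `α = ξ + (α_i - ξ_i) e_i`: one factor
      have hαeq : α = ξ + Finsupp.single i (α i - ξ i) := by
        ext l
        rw [Finsupp.add_apply, Finsupp.single_apply]
        by_cases hl : i = l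
        · subst hl; rw [if_pos rfl]; omega
        · rw [if_neg hl, hone l (Ne.symm hl), add_zero]
      rw [prod_eq_single i (fun l _ hl => by rw [hone l hl, Nat.sub_self]; exact hν0 l)
        (fun h => absurd (mem_univ i) h), hν, lineMultiplier, ← hαeq, mul_div_cancel₀ _ hμξ.ne']
    · -- two directions `i ≠ j`: use (lambdas) at `γ = α - e_i - e_j`
      push Not at hone
      obtain ⟨j, hji, hj⟩ := hone
      have hj' : ξ j < α j := lt_of_le_of_ne (Finsupp.le_def.1 h1 j) (Ne.symm hj)
      have hij : i ≠ j := Ne.symm hji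
      set γ := α - Finsupp.single i 1 - Finsupp.single j 1 with hγ
      have hγi : γ i + 1 = α i := by
        rw [hγ, Finsupp.tsub_apply, Finsupp.tsub_apply, Finsupp.single_apply, Finsupp.single_apply, if_pos rfl,
          if_neg hji]; omega
      have hγj : γ j + 1 = α j := by
        rw [hγ, Finsupp.tsub_apply, Finsupp.tsub_apply, Finsupp.single_apply, Finsupp.single_apply, if_neg hij,
          if_pos rfl]; omega
      have hγl : ∀ l, l ≠ i → l ≠ j → γ l = α l := fun l hli hlj => by
        rw [hγ, Finsupp.tsub_apply, Finsupp.tsub_apply, Finsupp.single_apply, Finsupp.single_apply,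
          if_neg (Ne.symm hli), if_neg (Ne.symm hlj)]; omega
      -- coordinates of the four points
      have hγi_i : (γ + Finsupp.single i 1 : τ →₀ ℕ) i = γ i + 1 := by
        rw [Finsupp.add_apply, Finsupp.single_apply, if_pos rfl]
      have hγi_j : (γ + Finsupp.single i 1 : τ →₀ ℕ) j = γ j := by
        rw [Finsupp.add_apply, Finsupp.single_apply, if_neg hij, add_zero]
      have hγi_l : ∀ l, l ≠ i → (γ + Finsupp.single i 1 : τ →₀ ℕ) l = γ l := fun l hl => by
        rw [Finsupp.add_apply, Finsupp.single_apply, if_neg (Ne.symm hl), add_zero]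
      have hγj_j : (γ + Finsupp.single j 1 : τ →₀ ℕ) j = γ j + 1 := by
        rw [Finsupp.add_apply, Finsupp.single_apply, if_pos rfl]
      have hγj_l : ∀ l, l ≠ j → (γ + Finsupp.single j 1 : τ →₀ ℕ) l = γ l := fun l hl => by
        rw [Finsupp.add_apply, Finsupp.single_apply, if_neg (Ne.symm hl), add_zero]
      have hα' : γ + Finsupp.single i 1 + Finsupp.single j 1 = α := by
        ext l
        rw [Finsupp.add_apply]
        by_cases hlj : l = j
        · subst hlj; rw [hγi_j, Finsupp.single_apply, if_pos rfl, hγj]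
        · rw [Finsupp.single_apply, if_neg (Ne.symm hlj), add_zero]
          by_cases hli : l = i
          · subst hli; rw [hγi_i, hγi]
          · rw [hγi_l l hli, hγl l hli hlj]
      -- bounds
      have hξγ : ξ ≤ γ := Finsupp.le_def.2 fun l => by
        by_cases hli : l = i
        · subst hli; omega
        · by_cases hlj : l = j
          · subst hlj; omega
          · rw [hγl l hli hlj]; exact Finsupp.le_def.1 h1 l
      have hγκ : γ + Finsupp.single i 1 + Finsupp.single j 1 ≤ κ := by rw [hα']; exact h2
      have hγi_le : γ + Finsupp.single i 1 ≤ κ :=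
        le_trans (Finsupp.le_def.2 fun l => by rw [Finsupp.add_apply]; exact Nat.le_add_right _ _) hγκ
      have hγ_le : γ ≤ κ :=
        le_trans (Finsupp.le_def.2 fun l => by rw [Finsupp.add_apply]; exact Nat.le_add_right _ _) hγi_le
      have hγj_le : γ + Finsupp.single j 1 ≤ κ := by
        refine le_trans (Finsupp.le_def.2 fun l => ?_) hγκ
        rw [Finsupp.add_apply, Finsupp.add_apply, Finsupp.add_apply]; omega
      have hξγi : ξ ≤ γ + Finsupp.single i 1 :=
        hξγ.trans (Finsupp.le_def.2 fun l => by rw [Finsupp.add_apply]; exact Nat.le_add_right _ _)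
      have hξγj : ξ ≤ γ + Finsupp.single j 1 :=
        hξγ.trans (Finsupp.le_def.2 fun l => by rw [Finsupp.add_apply]; exact Nat.le_add_right _ _)
      -- degrees for the induction hypothesis
      have hdeg : (α - ξ) = (γ - ξ) + Finsupp.single i 1 + Finsupp.single j 1 := by
        ext l
        rw [Finsupp.add_apply, Finsupp.add_apply, Finsupp.tsub_apply, Finsupp.tsub_apply, Finsupp.single_apply,
          Finsupp.single_apply]
        have hξl := Finsupp.le_def.1 hξγ l
        by_cases hli : i = l
        · subst hli; rw [if_pos rfl, if_neg hji]; omega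
        · rw [if_neg hli]
          by_cases hlj : j = l
          · subst hlj; rw [if_pos rfl]; omega
          · rw [if_neg hlj, hγl l (Ne.symm hli) (Ne.symm hlj), add_zero, add_zero]
      have hdegN : (γ - ξ).degree + 2 ≤ N + 1 := by
        have := congrArg Finsupp.degree hdeg
        rw [map_add, map_add, Finsupp.degree_single, Finsupp.degree_single] at this
        omega
      have hdeg_i : (γ + Finsupp.single i 1 - ξ) = (γ - ξ) + Finsupp.single i 1 := by
        ext l
        rw [Finsupp.add_apply, Finsupp.tsub_apply, Finsupp.tsub_apply, Finsupp.add_apply, Finsupp.single_apply]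
        have hξl := Finsupp.le_def.1 hξγ l
        split_ifs <;> omega
      have hdeg_j : (γ + Finsupp.single j 1 - ξ) = (γ - ξ) + Finsupp.single j 1 := by
        ext l
        rw [Finsupp.add_apply, Finsupp.tsub_apply, Finsupp.tsub_apply, Finsupp.add_apply, Finsupp.single_apply]
        have hξl := Finsupp.le_def.1 hξγ l
        split_ifs <;> omega
      have ihγ := ih γ (by omega) hξγ hγ_le
      have ihγi := ih (γ + Finsupp.single i 1)
        (by rw [hdeg_i, map_add, Finsupp.degree_single]; omega) hξγi hγi_le
      have ihγj := ih (γ + Finsupp.single j 1)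
        (by rw [hdeg_j, map_add, Finsupp.degree_single]; omega) hξγj hγj_le
      -- (lambdas)
      have hlam := realMultiplier_mul_eq hst hu1 hu hij hγκ
      rw [hα'] at hlam
      change μ γ * μ α = μ (γ + Finsupp.single i 1) * μ (γ + Finsupp.single j 1) at hlam
      -- the product identity
      have hprod : (∏ l, ν l (γ l - ξ l)) * ∏ l, ν l (α l - ξ l) =
          (∏ l, ν l ((γ + Finsupp.single i 1 : τ →₀ ℕ) l - ξ l)) *
            ∏ l, ν l ((γ + Finsupp.single j 1 : τ →₀ ℕ) l - ξ l) := by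
        rw [← prod_mul_distrib, ← prod_mul_distrib]
        refine prod_congr rfl fun l _ => ?_
        by_cases hli : l = i
        · subst hli
          rw [hγi_i, hγj_l l hij, ← hγi, mul_comm]
        · by_cases hlj : l = j
          · subst hlj
            rw [hγi_j, hγj_j, ← hγj]
          · rw [hγi_l l hli, hγj_l l hlj, hγl l hli hlj]
      have hμγ : 0 < μ γ := hμpos γ hξγ hγ_le
      have key : μ γ * μ α = μ γ * (μ ξ * ∏ l, ν l (α l - ξ l)) := by
        rw [hlam, ihγi, ihγj]
        calc μ ξ * (∏ l, ν l ((γ + Finsupp.single i 1 : τ →₀ ℕ) l - ξ l)) *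
              (μ ξ * ∏ l, ν l ((γ + Finsupp.single j 1 : τ →₀ ℕ) l - ξ l))
            = μ ξ * μ ξ * ((∏ l, ν l ((γ + Finsupp.single i 1 : τ →₀ ℕ) l - ξ l)) *
                ∏ l, ν l ((γ + Finsupp.single j 1 : τ →₀ ℕ) l - ξ l)) := by ring
          _ = μ ξ * μ ξ * ((∏ l, ν l (γ l - ξ l)) * ∏ l, ν l (α l - ξ l)) := by rw [hprod]
          _ = (μ ξ * ∏ l, ν l (γ l - ξ l)) * (μ ξ * ∏ l, ν l (α l - ξ l)) := by ring
          _ = μ γ * (μ ξ * ∏ l, ν l (α l - ξ l)) := by rw [← ihγ]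
      exact mul_left_cancel₀ hμγ.ne' key

end Split

/-! ## §4 Lemma 4.3 -/

section Lemma43

variable [Fintype τ] [DecidableEq τ]

/-- **The factors `f_l(t) = Σ_{ξ_l ≤ k ≤ κ_l} (-1)^k binom(κ_l,k) ν_l(k - ξ_l) t^k ∈ ℝ[t]`.**
[cite: BorceaBranden2009II, §4 proof of Lemma 4.3 ("`f` will split into a product as in the statement of the
lemma")] -/
def factorPoly (g : MvPolynomial τ ℂ) (u : ℂ) (l : τ) : Polynomial ℝ :=
  ∑ k ∈ range (degVec g l + 1), Polynomial.monomial k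
    (if infVec g l ≤ k then (-1) ^ k * ((degVec g l).choose k : ℝ) * lineMultiplier g u l (k - infVec g l) else 0)

omit [DecidableEq τ] in
/-- `f_l(X_l) = Σ_k r_l(k) X_l^k` inside `ℂ[z_τ]`. [cite: BorceaBranden2009II, §4 proof of Lemma 4.3] -/
theorem aeval_X_factorPoly (g : MvPolynomial τ ℂ) (u : ℂ) (l : τ) :
    Polynomial.aeval (X l : MvPolynomial τ ℂ) (factorPoly g u l) =
      ∑ k ∈ range (degVec g l + 1), C (((if infVec g l ≤ k then
        (-1) ^ k * ((degVec g l).choose k : ℝ) * lineMultiplier g u l (k - infVec g l) else 0 : ℝ) : ℂ)) *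
          X l ^ k := by
  rw [factorPoly, map_sum]
  refine sum_congr rfl fun k _ => ?_
  rw [Polynomial.aeval_monomial, MvPolynomial.algebraMap_apply, Complex.coe_algebraMap]

/-- **The factorisation `g = C · Π_l f_l(t_l)`** with `C = u^{-1} μ(ξ)`: the coefficient identity
`a(α) = u^{-1}(-1)^α binom(κ,α) μ(α)` combined with (split). [cite: BorceaBranden2009II, §4 proof of Lemma 4.3
("This will then prove the necessity part since `f` will split into a product as in the statement of the lemma")] -/
theorem eq_C_mul_prod_factorPoly {g : MvPolynomial τ ℂ} (hst : IsUpperHalfPlaneStable (diagSubst g)) {u : ℂ}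
    (hu1 : ‖u‖ = 1)
    (hu : ∀ α : τ →₀ ℕ, (u * ((-1) ^ α.degree * coeff α g)).im = 0 ∧ 0 ≤ (u * ((-1) ^ α.degree * coeff α g)).re) :
    g = C (u⁻¹ * (realMultiplier g u (infVec g) : ℂ)) *
      ∏ l, Polynomial.aeval (X l : MvPolynomial τ ℂ) (factorPoly g u l) := by
  have hu0 : u ≠ 0 := fun h => by rw [h, norm_zero] at hu1; exact zero_ne_one hu1
  set ξ := infVec g with hξ
  set κ := degVec g with hκ
  -- the coefficient function of `f_l`
  set r : τ → ℕ → ℝ := fun l k => if ξ l ≤ k then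
      (-1) ^ k * ((κ l).choose k : ℝ) * lineMultiplier g u l (k - ξ l) else 0 with hr
  have hfac : ∀ l, Polynomial.aeval (X l : MvPolynomial τ ℂ) (factorPoly g u l) =
      ∑ k ∈ range (κ l + 1), C ((r l k : ℝ) : ℂ) * X l ^ k := fun l => aeval_X_factorPoly g u l
  simp_rw [hfac]
  rw [prod_univ_sum, mul_sum]
  conv_lhs => rw [eq_sum_box (β := fun i => κ i) (p := g) (fun i => by rw [hκ, degVec_apply])]
  refine sum_congr rfl fun m hm => ?_
  have hmκ : toF m ≤ κ := Finsupp.le_def.2 fun i => by rw [toF_apply]; exact mem_box_iff.1 hm i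
  -- both sides are scalar multiples of the monomial `z^m`
  have hrhs : C (u⁻¹ * (realMultiplier g u ξ : ℂ)) * ∏ l, C ((r l (m l) : ℝ) : ℂ) * (X l : MvPolynomial τ ℂ) ^ m l =
      (u⁻¹ * (realMultiplier g u ξ : ℂ) * ∏ l, ((r l (m l) : ℝ) : ℂ)) • ∏ l, (X l : MvPolynomial τ ℂ) ^ m l := by
    rw [prod_mul_distrib, smul_eq_C_mul, show C (u⁻¹ * (realMultiplier g u ξ : ℂ) * ∏ l, ((r l (m l) : ℝ) : ℂ)) =
      C (u⁻¹ * (realMultiplier g u ξ : ℂ)) * ∏ l, C ((r l (m l) : ℝ) : ℂ) from by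
        rw [_root_.map_mul, _root_.map_prod], mul_assoc]
  rw [hrhs]
  congr 1
  by_cases hξm : ξ ≤ toF m
  · -- inside the box: `a(α) = u⁻¹ (-1)^α binom(κ,α) μ(α)` and (split)
    have hsplit := realMultiplier_split hst hu1 hu hξm hmκ
    have hμ := realMultiplier_eq hu (toF m)
    -- `u λ(α) = μ(α)` unfolded: `u (-1)^|α| (Π binom)⁻¹ a(α) = μ(α)`
    rw [diagMultiplier] at hμ
    have hb := prod_choose_ne_zero hmκ
    have hsign : ((-1 : ℂ) ^ (toF m).degree) * (-1) ^ (toF m).degree = 1 := by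
      rw [← pow_add, ← two_mul, pow_mul]; norm_num
    have ha : coeff (toF m) g = u⁻¹ * (-1) ^ (toF m).degree * (∏ i, (((κ i).choose (toF m i) : ℕ) : ℂ)) *
        (realMultiplier g u (toF m) : ℂ) := by
      rw [hμ]
      calc coeff (toF m) g = (u⁻¹ * u) * ((-1 : ℂ) ^ (toF m).degree * (-1) ^ (toF m).degree) *
            ((∏ i, (((κ i).choose (toF m i) : ℕ) : ℂ)) * (∏ i, (((κ i).choose (toF m i) : ℕ) : ℂ))⁻¹) *
            coeff (toF m) g := by rw [inv_mul_cancel₀ hu0, hsign, mul_inv_cancel₀ hb]; ring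
        _ = _ := by rw [hκ]; ring
    rw [ha, hsplit, Complex.ofReal_mul, Complex.ofReal_prod, Finsupp.degree_eq_sum, ← prod_pow_eq_pow_sum]
    have hrl : ∀ l, ((r l (m l) : ℝ) : ℂ) =
        (-1) ^ m l * (((κ l).choose (m l) : ℕ) : ℂ) * (lineMultiplier g u l (m l - ξ l) : ℂ) := fun l => by
      rw [hr]
      simp only [if_pos (show ξ l ≤ m l from toF_apply m l ▸ Finsupp.le_def.1 hξm l)]
      push_cast
      ring
    simp_rw [hrl, toF_apply, prod_mul_distrib]
    ring
  · -- outside the box: both sides vanish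
    have ha : coeff (toF m) g = 0 := by
      by_contra h
      exact hξm ((coeff_ne_zero_iff_mem_box hst _).1 h).1
    obtain ⟨l, hl⟩ : ∃ l, m l < ξ l := by
      by_contra h
      push Not at h
      exact hξm (Finsupp.le_def.2 fun l => (toF_apply m l).symm ▸ h l)
    rw [ha, prod_eq_zero (mem_univ l) (by rw [hr]; simp only [if_neg (not_le.2 hl)]; push_cast; rfl), mul_zero]

omit [DecidableEq τ] in
/-- `f(z,w) = C Π_l f_l(z_lw_l)`. [cite: BorceaBranden2009II, §4 Lemma 4.3 ("`f(z,w) = C f_1(z_1w_1)⋯f_n(z_nw_n)`")] -/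
theorem diagSubst_C_mul_prod_aeval (c : ℂ) (f : τ → Polynomial ℝ) :
    diagSubst (C c * ∏ l, Polynomial.aeval (X l : MvPolynomial τ ℂ) (f l)) =
      C c * ∏ l, Polynomial.aeval (X (Sum.inl l) * X (Sum.inr l) : MvPolynomial (τ ⊕ τ) ℂ) (f l) := by
  rw [_root_.map_mul, _root_.map_prod]
  have hC : diagSubst (C c : MvPolynomial τ ℂ) = C c := bind₁_C_right _ _
  rw [hC]
  congr 1
  refine prod_congr rfl fun l _ => ?_
  have h := Polynomial.aeval_algHom_apply ((diagSubst (τ := τ)).restrictScalars ℝ) (X l : MvPolynomial τ ℂ) (f l)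
  rw [AlgHom.restrictScalars_apply, AlgHom.restrictScalars_apply] at h
  rw [← h, diagSubst, bind₁_X_right]

omit [DecidableEq τ] in
/-- Evaluating `Π_l f_l(z_lw_l)` at a point. [cite: BorceaBranden2009II, §4 Lemma 4.3] -/
theorem eval_C_mul_prod_aeval (c : ℂ) (f : τ → Polynomial ℝ) (Z : τ ⊕ τ → ℂ) :
    eval Z (C c * ∏ l, Polynomial.aeval (X (Sum.inl l) * X (Sum.inr l) : MvPolynomial (τ ⊕ τ) ℂ) (f l)) =
      c * ∏ l, Polynomial.aeval (Z (Sum.inl l) * Z (Sum.inr l)) (f l) := by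
  rw [_root_.map_mul, eval_C, _root_.map_prod]
  congr 1
  refine prod_congr rfl fun l _ => ?_
  have h := Polynomial.aeval_algHom_apply ((MvPolynomial.aeval Z).restrictScalars ℝ)
    (X (Sum.inl l) * X (Sum.inr l) : MvPolynomial (τ ⊕ τ) ℂ) (f l)
  rw [AlgHom.restrictScalars_apply, AlgHom.restrictScalars_apply, MvPolynomial.aeval_eq_eval] at h
  rw [← h]
  simp only [_root_.map_mul, eval_X]

omit [Fintype τ] [DecidableEq τ] in
/-- `zw ∉ [0,∞)` for `z, w ∈ H`. [cite: BorceaBranden2009II, §4 proof of Lemma 4.3 ("if `μ ≤ 0` then `μ + zw` is a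
stable polynomial in two variables")] -/
theorem not_nonneg_real_mul_of_im_pos {z w : ℂ} (hz : 0 < z.im) (hw : 0 < w.im) :
    ¬((z * w).im = 0 ∧ 0 ≤ (z * w).re) := by
  rintro ⟨him, hre⟩
  have hz0 : z ≠ 0 := fun h0 => by rw [h0, Complex.zero_im] at hz; exact lt_irrefl _ hz
  set t : ℝ := (z * w).re with ht
  have hzw : z * w = (t : ℂ) := Complex.ext (by simp [ht]) (by simp [him])
  have hw' : w = (t : ℂ) * z⁻¹ := by rw [eq_mul_inv_iff_mul_eq₀ hz0, mul_comm]; exact hzw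
  have : w.im ≤ 0 := by
    rw [hw', Complex.mul_im, Complex.ofReal_re, Complex.ofReal_im, zero_mul, add_zero, Complex.inv_im]
    exact mul_nonpos_of_nonneg_of_nonpos hre
      (div_nonpos_of_nonpos_of_nonneg (neg_nonpos.2 hz.le) (Complex.normSq_nonneg _))
  linarith

omit [Fintype τ] [DecidableEq τ] in
/-- Every `t ∉ [0,∞)` is a product `s · s` with `s ∈ H`. [cite: BorceaBranden2009II, §4 proof of Lemma 4.3
("`f_j(z_jw_j)` is necessarily stable")] -/
theorem exists_sq_eq_of_not_nonneg_real {t : ℂ} (ht : ¬(t.im = 0 ∧ 0 ≤ t.re)) :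
    ∃ s : ℂ, 0 < s.im ∧ s * s = t := by
  obtain ⟨s, hs⟩ := IsAlgClosed.exists_pow_nat_eq t zero_lt_two
  rw [pow_two] at hs
  rcases lt_trichotomy 0 s.im with h | h | h
  · exact ⟨s, h, hs⟩
  · exfalso
    apply ht
    rw [← hs]
    constructor
    · rw [Complex.mul_im, ← h]; ring
    · rw [Complex.mul_re, ← h]; nlinarith
  · exact ⟨-s, by rw [Complex.neg_im]; linarith, by rw [neg_mul_neg, hs]⟩

omit [DecidableEq τ] in
/-- **Lemma 4.3, sufficiency: `C Π_l f_l(z_lw_l)` is stable** when `C ≠ 0` and every `f_l` has only real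
non-negative zeros ("if `μ ≤ 0` then `μ + zw` is a stable polynomial in two variables").
[cite: BorceaBranden2009II, §4 Lemma 4.3 (sufficiency)] -/
theorem isUpperHalfPlaneStable_diagSubst_of_eq {g : MvPolynomial τ ℂ} {c : ℂ} {f : τ → Polynomial ℝ} (hc : c ≠ 0)
    (hf : ∀ l (t : ℂ), Polynomial.aeval t (f l) = 0 → t.im = 0 ∧ 0 ≤ t.re)
    (hg : g = C c * ∏ l, Polynomial.aeval (X l : MvPolynomial τ ℂ) (f l)) :
    IsUpperHalfPlaneStable (diagSubst g) := by
  intro Z hZ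
  rw [hg, diagSubst_C_mul_prod_aeval, eval_C_mul_prod_aeval]
  refine mul_ne_zero hc (prod_ne_zero_iff.2 fun l _ h0 => ?_)
  exact not_nonneg_real_mul_of_im_pos (hZ _) (hZ _) (hf l _ h0)

/-- **Lemma 4.3, the zeros of the factors**: if `g = C Π_l f_l(t_l)` with `C ≠ 0` and `f = g(zw)` is stable, then
every zero of every `f_l` is real and non-negative ("`f_j(z_jw_j)` is necessarily stable"; a zero `t ∉ [0,∞)` is
`t = s²` with `s ∈ H`, and `f` would vanish at `z_l = w_l = s`). [cite: BorceaBranden2009II, §4 proof of Lemma 4.3] -/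
theorem roots_of_isUpperHalfPlaneStable_diagSubst {g : MvPolynomial τ ℂ} (hst : IsUpperHalfPlaneStable (diagSubst g))
    {c : ℂ} {f : τ → Polynomial ℝ} (hg : g = C c * ∏ l, Polynomial.aeval (X l : MvPolynomial τ ℂ) (f l))
    (l : τ) (t : ℂ) (ht : Polynomial.aeval t (f l) = 0) : t.im = 0 ∧ 0 ≤ t.re := by
  by_contra hnot
  obtain ⟨s, hs, hst2⟩ := exists_sq_eq_of_not_nonneg_real hnot
  set Z : τ ⊕ τ → ℂ := fun x => Sum.elim (fun l' => if l' = l then s else Complex.I)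
    (fun l' => if l' = l then s else Complex.I) x with hZ
  have hZim : ∀ x, 0 < (Z x).im := by
    rintro (l' | l') <;> simp only [hZ, Sum.elim_inl, Sum.elim_inr] <;> split_ifs <;> simp [hs]
  apply hst Z hZim
  rw [hg, diagSubst_C_mul_prod_aeval, eval_C_mul_prod_aeval]
  refine mul_eq_zero.2 (Or.inr (prod_eq_zero (mem_univ l) ?_))
  have hZl : Z (Sum.inl l) * Z (Sum.inr l) = t := by simp [hZ, hst2]
  rw [hZl]
  exact ht

/-- **Borcea–Brändén II, Lemma 4.3.** "Let `f(z,w) = Σ_{α ∈ ℕⁿ} a(α) z^α w^α ∈ ℂ[z_1,…,z_n,w_1,…,w_n]`. Then `f`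
is stable if and only if it can be written as `f(z,w) = C f_1(z_1w_1)⋯f_n(z_nw_n)`, where `C ∈ ℂ` and
`f_1(t),…,f_n(t)` are univariate real polynomials with real and non-negative zeros only." Here `f = g(zw)`
(`diagSubst g`, `g = Σ a(α) t^α`), the factorisation is stated for `g` (`g = C Π_l f_l(t_l)`, equivalently
`f = C Π_l f_l(z_lw_l)` by `diagSubst_C_mul_prod_aeval`), and `C ≠ 0` is made explicit (the zero polynomial is not
stable). Proof as printed (support = box via [Br1], the stability preserver `T`, the phase (Lemma 4.2), (peacy),
(lambdas), (split)). [cite: BorceaBranden2009II, §4 Lemma 4.3] -/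
theorem isUpperHalfPlaneStable_diagSubst_iff (g : MvPolynomial τ ℂ) :
    IsUpperHalfPlaneStable (diagSubst g) ↔
      ∃ (c : ℂ) (f : τ → Polynomial ℝ), c ≠ 0 ∧
        (∀ l (t : ℂ), Polynomial.aeval t (f l) = 0 → t.im = 0 ∧ 0 ≤ t.re) ∧
        g = C c * ∏ l, Polynomial.aeval (X l : MvPolynomial τ ℂ) (f l) := by
  constructor
  · intro hst
    obtain ⟨u, hu1, hu⟩ := exists_phase hst
    have hu0 : u ≠ 0 := fun h => by rw [h, norm_zero] at hu1; exact zero_ne_one hu1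
    have hμξ : 0 < realMultiplier g u (infVec g) :=
      (realMultiplier_pos_iff hst hu1 hu _).2 ⟨le_rfl, infVec_le_degVec hst⟩
    have hg := eq_C_mul_prod_factorPoly hst hu1 hu
    refine ⟨_, factorPoly g u, mul_ne_zero (inv_ne_zero hu0) (by exact_mod_cast hμξ.ne'), ?_, hg⟩
    exact roots_of_isUpperHalfPlaneStable_diagSubst hst hg
  · rintro ⟨c, f, hc, hf, hg⟩
    exact isUpperHalfPlaneStable_diagSubst_of_eq hc hf hg

/-- **Lemma 4.3 on `f(z,w)` itself**: a stable `f = Σ a(α) z^α w^α` factors as `C Π_l f_l(z_lw_l)` with `C ≠ 0` and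
real `f_l` having only real non-negative zeros. [cite: BorceaBranden2009II, §4 Lemma 4.3] -/
theorem IsUpperHalfPlaneStable.exists_diagSubst_eq_prod {g : MvPolynomial τ ℂ}
    (hst : IsUpperHalfPlaneStable (diagSubst g)) :
    ∃ (c : ℂ) (f : τ → Polynomial ℝ), c ≠ 0 ∧
      (∀ l (t : ℂ), Polynomial.aeval t (f l) = 0 → t.im = 0 ∧ 0 ≤ t.re) ∧
      diagSubst g = C c * ∏ l, Polynomial.aeval (X (Sum.inl l) * X (Sum.inr l) : MvPolynomial (τ ⊕ τ) ℂ) (f l) := by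
  obtain ⟨c, f, hc, hf, hg⟩ := (isUpperHalfPlaneStable_diagSubst_iff g).1 hst
  exact ⟨c, f, hc, hf, by rw [hg, diagSubst_C_mul_prod_aeval]⟩

end Lemma43

end Literature.Combinatorics.StablePolynomials

end
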